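import Summits.KontsevichZagierPeriods.KontsevichZagierPeriods.Theorems.LinRedNormalFormArrangementNormalFormStubRebaseSimpleZeroNestedDiffE1Cell

/-!
# Stub `stub_rebaseSimpleZeroTwo`, part `rebaseSimpleZero_HDiff1_of_HPar1` (crux
`ArrangementNormalForm`, line `janus-bands`) — brick `NestedDiffE1Grid`

**The interval normal form `HDiff₁` from `HPar1`, away from the singular ends.** For a datum of
`HDiff₁` (`RebaseE1.IsDN`: clean nest `A(y) < tᵢ < tⱼ < B(y)` over `{l < y < u}`, inner letter
constant, outer letter of slope `λ ≠ 0`, base pole `r` outside the open interval):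
* `IsDN.good_grid` / `IsDN.good_middle` — if the band does not pinch at the ends
  (`A(l) < B(l)`, `A(u) < B(u)`) and the pole is off the closed interval, an explicit rational grid
  (rule 1a, `IsDN.good_split`) of mesh `h = G₀/(16(|A'| + |B'| + |λ| + 1))`, `G₀` the smaller end
  gap, cuts the interval into thick short cells, each good by `IsDN.good_thin` (brick
  `NestedDiffE1Cell`) given `HPar1`;
* `IsDN.good_of_ends` — in general, cutting at `l + (u − l)/3` and `u − (u − l)/3` isolates the
  SINGULAR ends (a pinch `A = B` or the pole `r` at the end) into end pieces and leaves a middle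
  piece of the previous kind;
* `rebaseSimpleZero_HDiff1_of_HPar1_of_HEnd` (registered, literal binders of `HDiff₁`): `HDiff₁`
  follows from `HPar1` and the hypothesis `HEnd` = `HDiff₁` restricted to data with a singular
  end (`A(l) = B(l) ∨ A(u) = B(u) ∨ r = l ∨ r = u`), the residual pinch/pole-end configurations.

References: M. Kontsevich, D. Zagier, *Periods* (2001), §1.2, rules (1a), (2).
-/

noncomputable section

open Set MeasureTheory MvPolynomial
open Literature.NumberTheory.Transcendental Literature.ModelTheory.ExponentialFields

namespace Summit.KontsevichZagierPeriods.ArrangementNormalForm.JanusBands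

namespace RebaseE1

open SeparatePos RebasePos RebaseZero RebaseNest RebaseDiff

variable {i j : Fin 2} {s : KZ.IntegralRep (0 + 1 + 2)} {l u : ℚ} {A B : Cf} {T : BData}
  {p : MvPolynomial (Fin 0) ℚ} {a : Fin 2 → Option Cf} {ci cj : Cf}

/-! ### The grid -/

/-- The increment of `evq` over a rational sub-interval. [folklore] -/
theorem evq_sub_evq_le (c : Cf) {q q' h : ℚ} (hqq : |q - q'| ≤ h) :
    evq c q - evq c q' ≤ |c.1 (Fin.last 0)| * h := by
  have key : evq c q - evq c q' = c.1 (Fin.last 0) * (q - q') := by rw [evq, evq]; ring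
  rw [key]
  calc c.1 (Fin.last 0) * (q - q') ≤ |c.1 (Fin.last 0) * (q - q')| := le_abs_self _
    _ = |c.1 (Fin.last 0)| * |q - q'| := abs_mul _ _
    _ ≤ |c.1 (Fin.last 0)| * h := mul_le_mul_of_nonneg_left hqq (abs_nonneg _)

/-- Rational bookkeeping of one grid cell: the gap `G₀` at the right end and a mesh `h` with
`(|A'| + |B'| + |λ| + 1) h ≤ G₀/16` give the thickness hypotheses of `IsDN.good_thin` with
`G = G₀/2`. [folklore] -/
theorem cell_arith {α β lam a₂ b₂ l u h G₀ : ℚ} (hlu : l < u) (hul : u - l ≤ h)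
    (hmesh : (|α| + |β| + |lam| + 1) * h ≤ G₀ / 16) (hgu : α * u + a₂ + G₀ ≤ β * u + b₂) :
    max (α * l + a₂) (α * u + a₂) + G₀ / 2 ≤ min (β * l + b₂) (β * u + b₂) ∧
      (|α| + |β| + |lam| + 1) * (u - l) ≤ (G₀ / 2) / 8 := by
  have h0 : 0 ≤ u - l := by linarith
  have e : (|α| + |β| + |lam| + 1) * h = |α| * h + |β| * h + |lam| * h + h := by ring
  rw [e] at hmesh
  have hp1 : 0 ≤ |lam| * h := mul_nonneg (abs_nonneg _) (by linarith)
  have hA : |α * l + a₂ - (α * u + a₂)| ≤ |α| * h := by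
    rw [show α * l + a₂ - (α * u + a₂) = α * (l - u) by ring, abs_mul]
    exact mul_le_mul_of_nonneg_left (by rw [abs_sub_comm, abs_of_nonneg h0]; exact hul) (abs_nonneg _)
  have hB : |β * l + b₂ - (β * u + b₂)| ≤ |β| * h := by
    rw [show β * l + b₂ - (β * u + b₂) = β * (l - u) by ring, abs_mul]
    exact mul_le_mul_of_nonneg_left (by rw [abs_sub_comm, abs_of_nonneg h0]; exact hul) (abs_nonneg _)
  obtain ⟨hA1, hA2⟩ := abs_le.1 hA
  obtain ⟨hB1, hB2⟩ := abs_le.1 hB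
  constructor
  · rcases le_total (α * l + a₂) (α * u + a₂) with hc | hc <;>
      rcases le_total (β * l + b₂) (β * u + b₂) with hd | hd
    · rw [max_eq_right hc, min_eq_left hd]; linarith
    · rw [max_eq_right hc, min_eq_right hd]; linarith
    · rw [max_eq_left hc, min_eq_left hd]; linarith
    · rw [max_eq_left hc, min_eq_right hd]; linarith
  · have : (|α| + |β| + |lam| + 1) * (u - l) ≤ (|α| + |β| + |lam| + 1) * h :=
      mul_le_mul_of_nonneg_left hul (by positivity)
    linarith

/-- **The grid** (induction on the number `n` of cells of mesh `h`): a datum of `HDiff₁` over an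
interval of length `≤ n h` on which `A + G₀ ≤ B` (closed interval) and off whose closure the pole
lies is good, given `HPar1` — cut at `l + h` (rule 1a); the left piece is one cell
(`IsDN.good_thin`), the right piece has `n − 1` cells. [Kontsevich–Zagier 2001, §1.2] -/
theorem good_grid (hL : LData T a i j ci cj) (hP : HParS T p a i j ci cj) (hK : Kc T p ≠ 0) (G₀ h : ℚ)
    (hG₀ : 0 < G₀) (hh : 0 < h) (hmesh : (|A.1 (Fin.last 0)| + |B.1 (Fin.last 0)| + |cj.1 (Fin.last 0)| + 1) * h ≤ G₀ / 16)
    (n : ℕ) : ∀ (s : KZ.IntegralRep (0 + 1 + 2)) (l u : ℚ), IsDN s l u A B T p a i j → u - l ≤ n * h →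
      (∀ q : ℚ, l ≤ q → q ≤ u → evq A q + G₀ ≤ evq B q) → (T.ℓ₂.2 < l ∨ u < T.ℓ₂.2) → Good 2 (KZ.of s) := by
  induction n with
  | zero =>
    intro s l u hN hn _ _
    push_cast at hn
    linarith [hN.lu]
  | succ n ih =>
    intro s l u hN hn hgap hr
    by_cases hc : u - l ≤ h
    · obtain ⟨h1, h2⟩ := cell_arith (a₂ := A.2) (b₂ := B.2) (lam := cj.1 (Fin.last 0)) hN.lu hc hmesh (hgap u hN.lu.le le_rfl)
      exact hN.good_thin hL hP hK (G₀ / 2) (by positivity) h1 h2 hr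
    · push Not at hc
      have hlq : l < l + h := by linarith
      have hqu : l + h < u := by linarith
      refine hN.good_split (l + h) hlq hqu (fun s₁ h₁ => ?_) fun s₂ h₂ => ?_
      · obtain ⟨e1, e2⟩ := cell_arith (a₂ := A.2) (b₂ := B.2) (lam := cj.1 (Fin.last 0)) h₁.lu (by linarith) hmesh
          (hgap (l + h) hlq.le hqu.le)
        exact h₁.good_thin hL hP hK (G₀ / 2) (by positivity) e1 e2 (hr.imp_right fun hr => hqu.trans hr)
      · refine ih s₂ (l + h) u h₂ (by push_cast at hn ⊢; linarith) (fun q hq1 hq2 => hgap q (by linarith) hq2)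
          (hr.imp_left fun hr => hr.trans hlq)

/-- **Regular intervals**: a datum of `HDiff₁` whose band does not pinch at the ends and whose
pole is off the closed interval is good, given `HPar1` (explicit grid of thick short cells).
[Kontsevich–Zagier 2001, §1.2] -/
theorem IsDN.good_middle (hN : IsDN s l u A B T p a i j) (hL : LData T a i j ci cj) (hP : HParS T p a i j ci cj)
    (hK : Kc T p ≠ 0) (hl : evq A l < evq B l) (hu : evq A u < evq B u) (hr : T.ℓ₂.2 < l ∨ u < T.ℓ₂.2) :
    Good 2 (KZ.of s) := by
  set G₀ : ℚ := min (evq B l - evq A l) (evq B u - evq A u) with hG₀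
  have hG₀0 : 0 < G₀ := lt_min (by linarith) (by linarith)
  set S : ℚ := |A.1 (Fin.last 0)| + |B.1 (Fin.last 0)| + |cj.1 (Fin.last 0)| + 1 with hS
  have hS0 : 0 < S := by positivity
  set h : ℚ := G₀ / 16 / S with hh
  have hh0 : 0 < h := by positivity
  have hmesh : S * h ≤ G₀ / 16 := by rw [hh, mul_div_cancel₀ _ hS0.ne']
  -- the gap on the closed interval
  have hgap : ∀ q : ℚ, l ≤ q → q ≤ u → evq A q + G₀ ≤ evq B q := fun q hq1 hq2 => by
    have key := min_ends_le_ev (B - A) hN.lu (y := q) (by exact_mod_cast hq1) (by exact_mod_cast hq2)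
    rw [ev_sub, ev_sub, ev_sub] at key
    simp only [ev_ratCast] at key
    have key' : min (evq B l - evq A l) (evq B u - evq A u) ≤ evq B q - evq A q := by exact_mod_cast key
    rw [← hG₀] at key'
    linarith
  -- the number of cells
  obtain ⟨n, hn⟩ := exists_nat_ge ((u - l) / h)
  have hn' : u - l ≤ n * h := by rwa [div_le_iff₀ hh0] at hn
  exact good_grid hL hP hK G₀ h hG₀0 hh0 hmesh n s l u hN hn' hgap hr

/-! ### Isolating the singular ends -/

/-- Non-empty fibres at an interior rational point. -/
theorem IsDN.evq_lt (hN : IsDN s l u A B T p a i j) {q : ℚ} (h1 : l < q) (h2 : q < u) : evq A q < evq B q := by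
  have := hN.AB q (by exact_mod_cast h1) (by exact_mod_cast h2)
  rw [ev_ratCast, ev_ratCast] at this
  exact_mod_cast this

/-- At the ends the fibres are weakly non-empty. -/
theorem IsDN.evq_le_ends (hN : IsDN s l u A B T p a i j) : evq A l ≤ evq B l ∧ evq A u ≤ evq B u := by
  have h0 : ∀ y : ℝ, (l : ℝ) < y → y < u → 0 ≤ ev (B - A) y := fun y h1 h2 => by
    rw [ev_sub]; linarith [hN.AB y h1 h2]
  have h1 := nonneg_left_end (B - A) hN.lu h0
  have h2 := nonneg_right_end (B - A) hN.lu h0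
  rw [ev_sub, ev_ratCast, ev_ratCast, sub_nonneg] at h1 h2
  exact ⟨by exact_mod_cast h1, by exact_mod_cast h2⟩

/-- **Isolating the singular ends.** A datum of `HDiff₁` is good, given `HPar1`, as soon as its
end pieces over `(l, l + (u − l)/3)` and `(u − (u − l)/3, u)` are good whenever the corresponding
end is SINGULAR (the band pinches there or the pole sits there): the rest is a regular interval
(`IsDN.good_middle`). [Kontsevich–Zagier 2001, §1.2, rule (1a)] -/
theorem IsDN.good_of_ends (hN : IsDN s l u A B T p a i j) (hL : LData T a i j ci cj) (hP : HParS T p a i j ci cj)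
    (hK : Kc T p ≠ 0)
    (hleft : (evq A l = evq B l ∨ T.ℓ₂.2 = l) → ∀ s₁ : KZ.IntegralRep (0 + 1 + 2),
      IsDN s₁ l (l + (u - l) / 3) A B T p a i j → Good 2 (KZ.of s₁))
    (hright : (evq A u = evq B u ∨ T.ℓ₂.2 = u) → ∀ s₂ : KZ.IntegralRep (0 + 1 + 2),
      IsDN s₂ (u - (u - l) / 3) u A B T p a i j → Good 2 (KZ.of s₂)) : Good 2 (KZ.of s) := by
  have hlu := hN.lu
  set d : ℚ := (u - l) / 3 with hd
  have hd0 : 0 < d := by rw [hd]; linarith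
  have hm1 : l < l + d := by linarith
  have hm1' : l + d < u := by rw [hd]; linarith
  have hm2 : l < u - d := by rw [hd]; linarith
  have hm2' : u - d < u := by linarith
  have hm12 : l + d < u - d := by rw [hd]; linarith
  have hA1 : evq A (l + d) < evq B (l + d) := hN.evq_lt hm1 hm1'
  have hA2 : evq A (u - d) < evq B (u - d) := hN.evq_lt hm2 hm2'
  obtain ⟨hel, heu⟩ := hN.evq_le_ends
  -- regular ends
  have regl : ¬ (evq A l = evq B l ∨ T.ℓ₂.2 = l) → evq A l < evq B l ∧ (T.ℓ₂.2 < l ∨ u ≤ T.ℓ₂.2) := fun h => by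
    push Not at h
    exact ⟨lt_of_le_of_ne hel h.1, hN.pole.imp_left fun hp => lt_of_le_of_ne hp h.2⟩
  have regu : ¬ (evq A u = evq B u ∨ T.ℓ₂.2 = u) → evq A u < evq B u ∧ (T.ℓ₂.2 ≤ l ∨ u < T.ℓ₂.2) := fun h => by
    push Not at h
    exact ⟨lt_of_le_of_ne heu h.1, hN.pole.imp_right fun hp => lt_of_le_of_ne hp (Ne.symm h.2)⟩
  by_cases hl : evq A l = evq B l ∨ T.ℓ₂.2 = l <;> by_cases hu : evq A u = evq B u ∨ T.ℓ₂.2 = u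
  · refine hN.good_split (l + d) hm1 hm1' (hleft hl) fun s₂ h₂ => ?_
    refine h₂.good_split (u - d) hm12 hm2' (fun s₃ h₃ => ?_) (hright hu)
    exact h₃.good_middle hL hP hK hA1 hA2 (hN.pole.imp (fun hp => lt_of_le_of_lt hp hm1) fun hp => hm2'.trans_le hp)
  · obtain ⟨hu1, hu2⟩ := regu hu
    refine hN.good_split (l + d) hm1 hm1' (hleft hl) fun s₂ h₂ => ?_
    exact h₂.good_middle hL hP hK hA1 hu1 (hu2.imp_left fun hp => lt_of_le_of_lt hp hm1)
  · obtain ⟨hl1, hl2⟩ := regl hl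
    refine hN.good_split (u - d) hm2 hm2' (fun s₁ h₁ => ?_) (hright hu)
    exact h₁.good_middle hL hP hK hl1 hA2 (hl2.imp_right fun hp => hm2'.trans_le hp)
  · obtain ⟨hl1, hl2⟩ := regl hl
    obtain ⟨hu1, hu2⟩ := regu hu
    refine hN.good_middle hL hP hK hl1 hu1 ?_
    rcases hl2 with hl2 | hl2
    · exact Or.inl hl2
    rcases hu2 with hu2 | hu2
    · exact absurd (hlu.trans_le hl2) (not_lt.2 hu2)
    · exact Or.inr hu2

/-- **The residual hypothesis `HEnd` on structured data**: every datum of `HDiff₁` with a SINGULAR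
end (the band pinches at an end of the interval, or the base pole sits at an end) is good for
`GG 0 2 2`. [Kontsevich–Zagier 2001, §1.2] -/
def HEndS (T : BData) (p : MvPolynomial (Fin 0) ℚ) (a : Fin 2 → Option Cf) (i j : Fin 2) : Prop :=
  ∀ (s : KZ.IntegralRep (0 + 1 + 2)) (l u : ℚ) (A B : Cf), IsDN s l u A B T p a i j →
    (evq A l = evq B l ∨ evq A u = evq B u ∨ T.ℓ₂.2 = l ∨ T.ℓ₂.2 = u) → Good 2 (KZ.of s)

/-- **`HDiff₁` from `HPar1` and `HEnd`, structured form.** [Kontsevich–Zagier 2001, §1.2] -/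
theorem IsDN.good_of_HEndS (hN : IsDN s l u A B T p a i j) (hL : LData T a i j ci cj) (hP : HParS T p a i j ci cj)
    (hE : HEndS T p a i j) : Good 2 (KZ.of s) := by
  by_cases hK : Kc T p = 0
  · exact hN.good_zero hK
  refine hN.good_of_ends hL hP hK (fun hl s₁ h₁ => hE _ _ _ _ _ h₁ ?_) fun hu s₂ h₂ => hE _ _ _ _ _ h₂ ?_
  · exact hl.elim Or.inl fun h => Or.inr (Or.inr (Or.inl h))
  · exact hu.elim (fun h => Or.inr (Or.inl h)) fun h => Or.inr (Or.inr (Or.inr h))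

end RebaseE1

open RebaseZero RebaseNest in
/-- **`HDiff₁` from `HPar1` and the residual end hypothesis `HEnd`** (registered part
`rebaseSimpleZero_HDiff1_of_HPar1_of_HEnd` of `stub_rebaseSimpleZeroTwo`, line `janus-bands`;
literal binders of the hypothesis `HDiff₁` of `rebaseSimpleZeroTwo_of_intervalGGset`). The interval
normal form `HDiff₁` of the two-fibre rebase — every clean nest `A(y) < tᵢ < tⱼ < B(y)` over a
literal rational interval `{l < y < u}` with constant inner letter, outer letter of non-zero
`y`-slope and base pole outside the open interval is congruent modulo `KZ.relations` to the
subgroup generated by `GG 0 2 2` — follows from (i) `HPar1`, its sub-case with a bound parallel to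
the letter of its own fibre (`A.1 (Fin.last 0) = ci.1 (Fin.last 0) ∨ B.1 (Fin.last 0) = cj.1
(Fin.last 0)`, worker W14), and (ii) `HEnd`, its sub-case with a SINGULAR END (the band pinches at
an end, `A(l) = B(l)` or `A(u) = B(u)`, or the pole sits at an end, `ℓ₂.2 = l` or `ℓ₂.2 = u`):
isolate the singular ends by two base cuts (`RebaseE1.IsDN.good_of_ends`), grid the regular middle
into thick short cells (`RebaseE1.IsDN.good_middle`) and dissect each cell by two interior cuts
and one sub-section box-Janus into `HPar1` nests and products (`RebaseE1.IsDN.good_thin`).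
[Kontsevich–Zagier 2001, §1.2, rules (1a), (2)] -/
theorem rebaseSimpleZero_HDiff1_of_HPar1_of_HEnd (HPar1 : ∀ (m : ℕ) (s : KZ.IntegralRep (0 + 1 + 2)) (L : Fin m → (Fin 0 → ℚ) × ℚ) (e : Fin m → ℕ) (p : MvPolynomial (Fin 0) ℚ) (ℓ₁ ℓ₂ : (Fin 0 → ℚ) × ℚ) (a : Fin 2 → Option ((Fin (0 + 1) → ℚ) × ℚ)) (lo hi : Fin 2 → Fin 2 ⊕ ((Fin (0 + 1) → ℚ) × ℚ)) (i j : Fin 2) (A B ci cj : (Fin (0 + 1) → ℚ) × ℚ) (l u : ℚ), i ≠ j → lo i = Sum.inr A → hi i = Sum.inl j → lo j = Sum.inl i → hi j = Sum.inr B → a i = some ci → a j = some cj → ci.1 (Fin.last 0) = 0 → cj.1 (Fin.last 0) ≠ 0 → (A.1 (Fin.last 0) = ci.1 (Fin.last 0) ∨ B.1 (Fin.last 0) = cj.1 (Fin.last 0)) → l < u → (∀ y : ℝ, (l : ℝ) < y → y < (u : ℝ) → RebaseZero.ev A y < RebaseZero.ev B y) → (ℓ₂.2 ≤ l ∨ u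 ≤ ℓ₂.2) → Bornology.IsBounded s.domain → s.domain = SeparatePos.gDom 0 2 2 ![RebaseZero.mk 1 (-l), RebaseZero.mk (-1) u] lo hi → EqOn s.integrand (RebasePos.glit 0 2 p L e ℓ₁ ℓ₂ 0 1 a) s.domain → ∃ c ∈ AddSubgroup.closure (SeparatePos.GGset 0 2 2), KZ.of s - c ∈ KZ.relations) (HEnd : ∀ (m : ℕ) (s : KZ.IntegralRep (0 + 1 + 2)) (L : Fin m → (Fin 0 → ℚ) × ℚ) (e : Fin m → ℕ) (p : MvPolynomial (Fin 0) ℚ) (ℓ₁ ℓ₂ : (Fin 0 → ℚ) × ℚ) (a : Fin 2 → Option ((Fin (0 + 1) → ℚ) × ℚ)) (lo hi : Fin 2 → Fin 2 ⊕ ((Fin (0 + 1) → ℚ) × ℚ)) (i j : Fin 2) (A B ci cj : (Fin (0 + 1) → ℚ) × ℚ) (l u : ℚ), i ≠ j → lo i = Sum.inr A → hi i = Sum.inl j → lo j = Sum.inl i → hi j = Sum.inr B → a i = some ci → a j = some cj → ci.1 (Fin.last 0) = 0 → cj.1 (Fin.last 0) ≠ 0 → (A.1 (Fin.last 0) * l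 + A.2 = B.1 (Fin.last 0) * l + B.2 ∨ A.1 (Fin.last 0) * u + A.2 = B.1 (Fin.last 0) * u + B.2 ∨ ℓ₂.2 = l ∨ ℓ₂.2 = u) → l < u → (∀ y : ℝ, (l : ℝ) < y → y < (u : ℝ) → RebaseZero.ev A y < RebaseZero.ev B y) → (ℓ₂.2 ≤ l ∨ u ≤ ℓ₂.2) → Bornology.IsBounded s.domain → s.domain = SeparatePos.gDom 0 2 2 ![RebaseZero.mk 1 (-l), RebaseZero.mk (-1) u] lo hi → EqOn s.integrand (RebasePos.glit 0 2 p L e ℓ₁ ℓ₂ 0 1 a) s.domain → ∃ c ∈ AddSubgroup.closure (SeparatePos.GGset 0 2 2), KZ.of s - c ∈ KZ.relations) (m : ℕ) (s : KZ.IntegralRep (0 + 1 + 2)) (L : Fin m → (Fin 0 → ℚ) × ℚ) (e : Fin m → ℕ) (p : MvPolynomial (Fin 0) ℚ) (ℓ₁ ℓ₂ : (Fin 0 → ℚ) × ℚ) (a : Fin 2 → Option ((Fin (0 + 1) → ℚ) × ℚ)) (lo hi : Fin 2 → Fin 2 ⊕ ((Fin (0 + 1) → ℚ) × ℚ)) (i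 j : Fin 2) (A B ci cj : (Fin (0 + 1) → ℚ) × ℚ) (l u : ℚ) (hij : i ≠ j) (hloi : lo i = Sum.inr A) (hhii : hi i = Sum.inl j) (hloj : lo j = Sum.inl i) (hhij : hi j = Sum.inr B) (hai : a i = some ci) (haj : a j = some cj) (hci : ci.1 (Fin.last 0) = 0) (hcj : cj.1 (Fin.last 0) ≠ 0) (hlu : l < u) (hAB : ∀ y : ℝ, (l : ℝ) < y → y < (u : ℝ) → RebaseZero.ev A y < RebaseZero.ev B y) (hpole : ℓ₂.2 ≤ l ∨ u ≤ ℓ₂.2) (hbd : Bornology.IsBounded s.domain) (hdom : s.domain = SeparatePos.gDom 0 2 2 ![RebaseZero.mk 1 (-l), RebaseZero.mk (-1) u] lo hi) (hint : EqOn s.integrand (RebasePos.glit 0 2 p L e ℓ₁ ℓ₂ 0 1 a) s.domain) : ∃ c ∈ AddSubgroup.closure (SeparatePos.GGset 0 2 2), KZ.of s - c ∈ KZ.relations := by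
  set T : BData := ⟨m, L, e, ℓ₁, ℓ₂, 0, 1⟩ with hT
  have hglit : RebasePos.glit 0 2 p L e ℓ₁ ℓ₂ 0 1 a = glitB T p a := rfl
  obtain ⟨hlo, hhi⟩ := eq_nlo_nhi hij hloi hhii hloj hhij
  subst hlo hhi
  have hL : RebaseE1.LData T a i j ci cj := ⟨hij, hai, haj, hci, hcj, rfl, rfl⟩
  have hN : RebaseE1.IsDN s l u A B T p a i j := ⟨hij, hdom, hglit ▸ hint, hbd, hlu, hAB, hpole⟩
  have hP : RebaseE1.HParS T p a i j ci cj := fun s' l' u' A' B' h' hpar =>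
    HPar1 m s' L e p ℓ₁ ℓ₂ a (nlo i A') (nhi j B') i j A' B' ci cj l' u' hij (nlo_self i A') (nhi_of_ne hij B')
      (nlo_of_ne hij A') (nhi_self j B') hai haj hci hcj hpar h'.lu h'.AB h'.pole h'.bdd h'.dom h'.int
  have hE : RebaseE1.HEndS T p a i j := fun s' l' u' A' B' h' hend =>
    HEnd m s' L e p ℓ₁ ℓ₂ a (nlo i A') (nhi j B') i j A' B' ci cj l' u' hij (nlo_self i A') (nhi_of_ne hij B')
      (nlo_of_ne hij A') (nhi_self j B') hai haj hci hcj hend h'.lu h'.AB h'.pole h'.bdd h'.dom h'.int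
  exact hN.good_of_HEndS hL hP hE

/-- **Registered brick `rebaseSimpleZero_E1middle`** (part `rebaseSimpleZero_HDiff1_of_HPar1` of
`stub_rebaseSimpleZeroTwo`, line `janus-bands`): a datum of the interval normal form `HDiff₁`
(`RebaseE1.IsDN`) with non-zero base constant whose band does not pinch at the ends of the
interval and whose base pole is off the closed interval is congruent modulo `KZ.relations` to
the subgroup generated by `GG 0 2 2`, given `HPar1` (`RebaseE1.IsDN.good_middle`: explicit grid of
thick short cells, each dissected into `HPar1` nests and products). [Kontsevich–Zagier 2001, §1.2] -/
theorem rebaseSimpleZero_E1middle (i j : Fin 2) (s : KZ.IntegralRep (0 + 1 + 2)) (l u : ℚ) (A B ci cj : (Fin (0 + 1) → ℚ) × ℚ) (T : RebaseZero.BData) (p : MvPolynomial (Fin 0) ℚ) (a : Fin 2 → Option ((Fin (0 + 1) → ℚ) × ℚ)) (hN : RebaseE1.IsDN s l u A B T p a i j) (hL : RebaseE1.LData T a i j ci cj) (hP : RebaseE1.HParS T p a i j ci cj) (hK : RebaseDiff.Kc T p ≠ 0) (hl : RebaseE1.evq A l < RebaseE1.evq B l) (hu : RebaseE1.evq A u <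 RebaseE1.evq B u) (hr : T.ℓ₂.2 < l ∨ u < T.ℓ₂.2) : RebaseZero.Good 2 (KZ.of s) :=
  hN.good_middle hL hP hK hl hu hr

end Summit.KontsevichZagierPeriods.ArrangementNormalForm.JanusBands
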